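import Literature.NumberTheory.LFunctions.FordLemma32C
import Literature.NumberTheory.LFunctions.WooleySimultaneousCongruences
import HarnessLib

/-!
# Ford's Lemma 3.2 (general `d`), part D: the congruence classes (`S₆' ≤ |𝓑*| · L_s`)

Topic `Literature/NumberTheory/LFunctions`. Everything here is PROVED.

K. Ford, Proc. LMS 85 (2002), proof of Lemma 3.2, from (3.6) to (3.7): the solutions of the
translated system satisfy `∑ Φ_j(z_i) ≡ ∑ Φ_j(w_i) (mod p^j)`; sorting `z` by its residues
`mod p^r` and by the residues `m_j` of `∑ Φ_j(z_i)` `(mod p^{min(j,r)})`, a refined Cauchy–Schwarz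
inequality gives `S₆' ≤ max_m |𝓑*(m)| · L_s(P,Q/p;Φ;p,q,r)`, and Wooley's theorem (Lemma 2.4) bounds
`|𝓑*(m)| ≤ (k−d)! p^{(r−d−1)(r−d)/2 + rd}`.

## References

* K. Ford, Proc. London Math. Soc. (3) 85 (2002), 565–633, proof of Lemma 3.2, (3.6)–(3.7).
  [Ford2002]
* T. D. Wooley, J. Number Theory 58 (1996), 288–297, Theorem 1 (= Ford's Lemma 2.4). [Wooley1996]
-/

noncomputable section

open Finset MeasureTheory Polynomial Complex
open scoped Real ComplexConjugate

namespace Literature.NumberTheory.LFunctions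
namespace FordVK

open VMV

/-! ### A refined Cauchy–Schwarz inequality for pair counts -/

section RefinedCS

variable {α γ : Type*} [DecidableEq γ]

/-- `#{(a,a') ∈ A² : f a = f a'} = ∑_y #f⁻¹(y)²`. [folklore] -/
theorem card_pairs_eq_sum_sq (A : Finset α) (f : α → γ) :
    ((A ×ˢ A).filter fun aa => f aa.1 = f aa.2).card = ∑ y ∈ A.image f, ((A.filter fun a => f a = y).card) ^ 2 := by
  rw [card_eq_sum_card_fiberwise (f := fun aa => f aa.1) (t := A.image f)]
  · refine sum_congr rfl fun y _ => ?_
    rw [sq, ← card_product]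
    congr 1
    ext ⟨a, a'⟩
    simp only [mem_filter, mem_product]
    constructor
    · rintro ⟨⟨⟨ha, ha'⟩, he⟩, hy⟩; exact ⟨⟨ha, hy⟩, ha', by rw [← he, hy]⟩
    · rintro ⟨⟨ha, hy⟩, ha', hy'⟩; exact ⟨⟨⟨ha, ha'⟩, by rw [hy, hy']⟩, hy⟩
  · intro aa haa
    rw [mem_coe, mem_filter, mem_product] at haa
    exact mem_image_of_mem _ haa.1.1

variable {V K B : Type*} [DecidableEq V] [DecidableEq K] [DecidableEq B]

/-- **Refined Cauchy–Schwarz.** If `v a = v a'` forces `κ a = κ a'`, and within each `κ`-class the map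
`β` takes at most `N` values, then
`#{(a,a') : v a = v a'} ≤ N · #{(a,a') : β a = β a' ∧ v a = v a'}`. This is the counting form of
Ford's `|∑_{z ∈ 𝓑*(m)} H(α;z)|² ≤ |𝓑*(m)| ∑_z |H(α;z)|²` summed over `m`. [cite: Ford2002, proof of
Lemma 3.2 (the display bounding `S₆(c,p)` before (3.7))] -/
theorem card_pairs_le_refined (A : Finset α) (v : α → V) (κ : α → K) (β : α → B) (N : ℕ)
    (hκ : ∀ a ∈ A, ∀ a' ∈ A, v a = v a' → κ a = κ a')
    (hN : ∀ a₀ ∈ A, ((A.filter fun a => κ a = κ a₀).image β).card ≤ N) :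
    ((A ×ˢ A).filter fun aa => v aa.1 = v aa.2).card
      ≤ N * ((A ×ˢ A).filter fun aa => β aa.1 = β aa.2 ∧ v aa.1 = v aa.2).card := by
  -- both sides fibrewise over `μ = v a`
  set Aμ : V → Finset α := fun μ => A.filter fun a => v a = μ with hAμ
  set Aμb : V → B → Finset α := fun μ b => A.filter fun a => v a = μ ∧ β a = b with hAμb
  have hL := card_pairs_eq_sum_sq A v
  have hR : ((A ×ˢ A).filter fun aa => β aa.1 = β aa.2 ∧ v aa.1 = v aa.2).card
      = ∑ μ ∈ A.image v, ∑ b ∈ (Aμ μ).image β, ((Aμb μ b).card) ^ 2 := by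
    rw [card_eq_sum_card_fiberwise (f := fun aa => v aa.1) (t := A.image v)]
    swap
    · intro aa haa; rw [mem_coe, mem_filter, mem_product] at haa; exact mem_image_of_mem _ haa.1.1
    refine sum_congr rfl fun μ _ => ?_
    rw [card_eq_sum_card_fiberwise (f := fun aa => β aa.1) (t := (Aμ μ).image β)]
    swap
    · intro aa haa
      rw [mem_coe, mem_filter, mem_filter, mem_product] at haa
      exact mem_image_of_mem _ (by rw [hAμ, mem_filter]; exact ⟨haa.1.1.1, haa.2⟩)
    refine sum_congr rfl fun b _ => ?_
    rw [sq, ← card_product]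
    congr 1
    ext ⟨a, a'⟩
    simp only [mem_filter, mem_product, hAμb]
    constructor
    · rintro ⟨⟨⟨⟨ha, ha'⟩, hβ, hv⟩, hμ⟩, hb⟩
      exact ⟨⟨ha, hμ, hb⟩, ha', by rw [← hv, hμ], by rw [← hβ, hb]⟩
    · rintro ⟨⟨ha, hμ, hb⟩, ha', hμ', hb'⟩
      exact ⟨⟨⟨⟨ha, ha'⟩, by rw [hb, hb'], by rw [hμ, hμ']⟩, hμ⟩, hb⟩
  rw [hL, hR, mul_sum]
  refine sum_le_sum fun μ _ => ?_
  -- `r(μ) = ∑_b r_{μ,b}`, `|B_μ| ≤ N`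
  have hsplit : (Aμ μ).card = ∑ b ∈ (Aμ μ).image β, (Aμb μ b).card := by
    rw [card_eq_sum_card_fiberwise (f := β) (t := (Aμ μ).image β) fun a ha => mem_image_of_mem _ (mem_coe.1 ha)]
    refine sum_congr rfl fun b _ => ?_
    congr 1
    ext a; simp only [hAμ, hAμb, mem_filter]; tauto
  have hBμ : ((Aμ μ).image β).card ≤ N := by
    rcases (Aμ μ).eq_empty_or_nonempty with h0 | ⟨a₀, ha₀⟩
    · rw [h0]; simp
    · have ha₀' := ha₀
      rw [hAμ, mem_filter] at ha₀'
      refine le_trans (card_le_card (image_subset_image ?_)) (hN a₀ ha₀'.1)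
      intro a ha
      rw [hAμ, mem_filter] at ha
      rw [mem_filter]
      exact ⟨ha.1, hκ a ha.1 a₀ ha₀'.1 (by rw [ha.2, ha₀'.2])⟩
  have e : (A.filter fun a => v a = μ) = Aμ μ := rfl
  rw [e, hsplit]
  calc (∑ b ∈ (Aμ μ).image β, (Aμb μ b).card) ^ 2
      ≤ ((Aμ μ).image β).card * ∑ b ∈ (Aμ μ).image β, (Aμb μ b).card ^ 2 := sq_sum_le_card_mul_sum_sq
    _ ≤ N * ∑ b ∈ (Aμ μ).image β, (Aμb μ b).card ^ 2 := Nat.mul_le_mul_right _ hBμ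

end RefinedCS

/-! ### Congruences for `Φ_j(z)` and `J_n(z;Φ)` -/

section Cong

variable {k : ℕ}

/-- `x ≡ y (mod M) ⟹ φ(x) ≡ φ(y) (mod M)`. [folklore] -/
theorem eval_modEq (φ : ℤ[X]) {M x y : ℤ} (h : x ≡ y [ZMOD M]) : φ.eval x ≡ φ.eval y [ZMOD M] := by
  rw [Int.modEq_iff_dvd] at h ⊢
  exact dvd_trans h (Polynomial.sub_dvd_eval_sub y x φ)

/-- Entrywise congruent integer matrices have congruent determinants. [folklore] -/
theorem det_modEq {n : ℕ} {M : ℤ} {A A' : Matrix (Fin n) (Fin n) ℤ} (h : ∀ i j, A i j ≡ A' i j [ZMOD M]) :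
    A.det ≡ A'.det [ZMOD M] := by
  rw [Matrix.det_apply', Matrix.det_apply']
  refine Int.ModEq.sum fun σ _ => ?_
  exact (Int.ModEq.prod fun i _ => h (σ i) i).mul_left _

/-- `z ≡ z' (mod M)` entrywise ⟹ `J_n(z;Φ) ≡ J_n(z';Φ) (mod M)`. [folklore] -/
theorem jac_modEq (Φ : PSystem k) (d n : ℕ) (hnd : n + d ≤ k) {M : ℤ} {z z' : Fin n → ℤ}
    (h : ∀ i, z i ≡ z' i [ZMOD M]) : jac Φ d n hnd z ≡ jac Φ d n hnd z' [ZMOD M] := by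
  unfold jac jacM
  exact det_modEq fun i c => by simp only [Matrix.of_apply]; exact eval_modEq _ (h i)

/-- `z ≡ z' (mod M)` entrywise ⟹ `∑ Φ_j(z_i) ≡ ∑ Φ_j(z'_i) (mod M)`. [folklore] -/
theorem tupSum_sysv_modEq (Φ : PSystem k) {M : ℤ} {z z' : Fin k → ℤ} (h : ∀ i, z i ≡ z' i [ZMOD M]) (j : Fin k) :
    tupSum (sysv Φ) z j ≡ tupSum (sysv Φ) z' j [ZMOD M] := by
  simp only [tupSum, Finset.sum_apply, sysv]
  exact Int.ModEq.sum fun i _ => eval_modEq _ (h i)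

end Cong

/-! ### The classes `𝓑*(m)` and the bound `S₆' ≤ max |𝓑*(m)| · L_s` -/

section Classes

variable {k : ℕ} (s P Q' : ℕ) (Φ : PSystem k) (q : ℤ) (d n : ℕ) (hnd : n + d ≤ k) (p r : ℕ)

/-- The class key `m(z) = (∑_i Φ_j(z_i) mod p^{min(j,r)})_{j > d}`. [cite: Ford2002, proof of Lemma 3.2 (`𝓑*(m)`)] -/
def mkey (z : Fin k → ℤ) : Fin k → ℤ :=
  fun j => if d ≤ j.val then tupSum (sysv Φ) z j % (p : ℤ) ^ min (j.val + 1) r else 0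

/-- The residues `z mod p^r`. [folklore] -/
def zres (z : Fin k → ℤ) : Fin k → ℤ := fun i => z i % (p : ℤ) ^ r

/-- **`𝓑*(m)`**: residue vectors `z̄ ∈ [0,p^r)^k` with `p ∤ J_n(z̄|ₙ;Φ)` and
`∑_i Φ_j(z̄_i) ≡ m_j (mod p^{min(j,r)})` for `j > d`. [cite: Ford2002, proof of Lemma 3.2 (`𝓑*(m)`)] -/
def Bstar (m : Fin k → ℤ) : Finset (Fin k → ℤ) :=
  (tuples k (Finset.Ico (0 : ℤ) ((p : ℤ) ^ r))).filter fun zb =>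
    ¬ ((p : ℤ) ∣ jac Φ d n hnd (headN (by omega) zb)) ∧ ∀ j : Fin k, d ≤ j.val → mkey Φ d p r zb j = m j

/-- The index set `A = Z̃ × [1,Q']^s` of the count `S₆'`. [cite: Ford2002, (3.6)] -/
def A6 : Finset ((Fin k → ℤ) × (Fin s → ℤ)) := Zt P Φ d n hnd p ×ˢ tuples s (Finset.Icc 1 (Q' : ℤ))

/-- The count `S₆'` for the system `Φ` itself (cf. `Sol6'`, where `Φ = transl (c̃q) Ψ`). [cite: Ford2002, (3.6)] -/
def S6count : ℕ := (((A6 s P Q' Φ d n hnd p) ×ˢ (A6 s P Q' Φ d n hnd p)).filter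
    fun aa => Kfreq Φ ((p : ℤ) * q) aa.1 = Kfreq Φ ((p : ℤ) * q) aa.2).card

/-- (i) Equal frequencies force equal class keys: `∑Φ_j(z_i) ≡ ∑Φ_j(w_i) (mod p^j)`.
[cite: Ford2002, proof of Lemma 3.2 ("By (3.6), ∑ (Φ_j(z_i) − Φ_j(w_i)) ≡ 0 (mod p^j)")] -/
theorem mkey_eq_of_Kfreq_eq {a a' : (Fin k → ℤ) × (Fin s → ℤ)}
    (h : Kfreq Φ ((p : ℤ) * q) a = Kfreq Φ ((p : ℤ) * q) a') : mkey Φ d p r a.1 = mkey Φ d p r a'.1 := by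
  funext j
  simp only [mkey]
  split_ifs with hj
  · have hj' := congrFun h j
    simp only [Kfreq, Pi.add_apply, tupSum_powv] at hj'
    -- `∑Φ_j(z) − ∑Φ_j(w) = (pq)^{j+1} (S_v − S_u)`
    have hd : ((p : ℤ) ^ (j.val + 1)) ∣ tupSum (sysv Φ) a'.1 j - tupSum (sysv Φ) a.1 j := by
      have e : tupSum (sysv Φ) a'.1 j - tupSum (sysv Φ) a.1 j
          = ((p : ℤ) * q) ^ (j.val + 1) * (psv k a.2 j - psv k a'.2 j) := by linear_combination -hj'
      rw [e, mul_pow, mul_assoc]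
      exact dvd_mul_right _ _
    have hmin : ((p : ℤ) ^ min (j.val + 1) r) ∣ (p : ℤ) ^ (j.val + 1) := pow_dvd_pow _ (min_le_left _ _)
    exact (Int.modEq_iff_dvd.2 (dvd_trans hmin hd))
  · rfl

/-- (ii) Within a class, the residues `z mod p^r` lie in `𝓑*(m(z₀))`. [cite: Ford2002, proof of Lemma 3.2] -/
theorem zres_mem_Bstar (hp : 0 < p) (hr : 1 ≤ r) {a a₀ : (Fin k → ℤ) × (Fin s → ℤ)} (ha : a ∈ A6 s P Q' Φ d n hnd p)
    (hκ : mkey Φ d p r a.1 = mkey Φ d p r a₀.1) :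
    zres p r a.1 ∈ Bstar Φ d n hnd p r (mkey Φ d p r a₀.1) := by
  have hpr : (0 : ℤ) < (p : ℤ) ^ r := by positivity
  rw [A6, mem_product, Zt, mem_filter] at ha
  have hcong : ∀ i, a.1 i ≡ zres p r a.1 i [ZMOD (p : ℤ) ^ r] := fun i => (Int.mod_modEq _ _).symm
  rw [Bstar, mem_filter, mem_tuples]
  refine ⟨fun i => ?_, ?_, fun j hj => ?_⟩
  · rw [Finset.mem_Ico]; exact ⟨Int.emod_nonneg _ hpr.ne', Int.emod_lt_of_pos _ hpr⟩
  · -- `J(z̄) ≡ J(z) (mod p^r)`, hence `(mod p)`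
    intro hdvd
    apply ha.1.2
    have hc := jac_modEq Φ d n hnd (M := (p : ℤ) ^ r) (z := headN (by omega) a.1) (z' := headN (by omega) (zres p r a.1))
      fun i => hcong _
    have hp1 : (p : ℤ) ∣ (p : ℤ) ^ r := dvd_pow_self _ (by omega)
    have hc' := hc.of_dvd hp1
    exact (Int.ModEq.dvd_iff hc').2 hdvd |> fun h => by simpa using h
  · rw [← congrFun hκ j]
    simp only [mkey, if_pos hj]
    have hc := (tupSum_sysv_modEq Φ hcong j).of_dvd (pow_dvd_pow (p : ℤ) (min_le_right (j.val + 1) r))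
    exact hc.symm

/-- **`S₆' ≤ N · L_s(P,Q';Φ;p,q,r)`** whenever `|𝓑*(m)| ≤ N` for all `m`. [cite: Ford2002, proof of Lemma 3.2
("S₆(c,p) ≤ ∑_m |𝓑*(m)| ∫ ∑_{z ∈ 𝓑*(m)} |H(α;z)|² |f|^{2s} ≤ (k−d)! p^{…} L_s(P,Q/p;Φ;p,q,r)")] -/
theorem S6count_le (hp : 0 < p) (hr : 1 ≤ r) {N : ℕ} (hN : ∀ m, (Bstar Φ d n hnd p r m).card ≤ N) :
    S6count s P Q' Φ q d n hnd p ≤ N * Ls s P Q' Φ p q r := by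
  classical
  have h1 := card_pairs_le_refined (A6 s P Q' Φ d n hnd p) (fun a => Kfreq Φ ((p : ℤ) * q) a)
    (fun a => mkey Φ d p r a.1) (fun a => zres p r a.1) N
    (fun a _ a' _ h => mkey_eq_of_Kfreq_eq s Φ q d p r h)
    (fun a₀ ha₀ => by
      refine le_trans (card_le_card ?_) (hN (mkey Φ d p r a₀.1))
      intro zb hzb
      rw [mem_image] at hzb
      obtain ⟨a, ha, rfl⟩ := hzb
      rw [mem_filter] at ha
      exact zres_mem_Bstar s P Q' Φ d n hnd p r hp hr ha.1 ha.2)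
  refine h1.trans (Nat.mul_le_mul_left N ?_)
  -- the refined pair set injects into the set counted by `L_s`
  rw [Ls]
  refine card_le_card fun aa haa => ?_
  rw [mem_filter, mem_product] at haa ⊢
  obtain ⟨⟨ha, ha'⟩, hβ, hv⟩ := haa
  rw [A6, mem_product, Zt, mem_filter] at ha ha'
  refine ⟨⟨by rw [mem_KI]; exact ⟨mem_tuples.1 ha.1.1, mem_tuples.1 ha.2⟩,
    by rw [mem_KI]; exact ⟨mem_tuples.1 ha'.1.1, mem_tuples.1 ha'.2⟩⟩, hv, fun i => ?_⟩
  have := congrFun hβ i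
  simp only [zres] at this
  exact (Int.ModEq.dvd (this.symm : aa.2.1 i % (p : ℤ) ^ r = aa.1.1 i % (p : ℤ) ^ r)) |> fun h => by
    simpa [sub_eq_add_neg] using h

end Classes

/-! ### Wooley's bound for `|𝓑*(m)|` -/

section WooleyBound

open MvPolynomial in
/-- `deg (φ(X_i)) ≤ deg φ` as a multivariate polynomial. [folklore] -/
theorem totalDegree_aeval_X_le {n : ℕ} (φ : ℤ[X]) (i : Fin n) :
    (Polynomial.aeval (X i : MvPolynomial (Fin n) ℤ) φ).totalDegree ≤ φ.natDegree := by
  rw [Polynomial.aeval_eq_sum_range]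
  refine totalDegree_finsetSum_le fun e he => ?_
  rw [Finset.mem_range] at he
  refine (totalDegree_smul_le _ _).trans ?_
  refine (totalDegree_pow _ _).trans ?_
  rw [totalDegree_X]; omega

open MvPolynomial in
/-- `φ(X_i)` evaluated at `x` is `φ(x_i)`. [folklore] -/
theorem eval_aeval_X {n : ℕ} (x : Fin n → ℤ) (φ : ℤ[X]) (i : Fin n) :
    MvPolynomial.eval x (Polynomial.aeval (X i : MvPolynomial (Fin n) ℤ) φ) = φ.eval (x i) := by
  induction φ using Polynomial.induction_on' with
  | add p q hp hq => simp only [map_add, Polynomial.eval_add, hp, hq]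
  | monomial e a => simp [Polynomial.aeval_monomial, Polynomial.eval_monomial]

open MvPolynomial in
/-- `∂_i φ(X_{i'}) = δ_{ii'} φ'(X_i)`. [folklore] -/
theorem pderiv_aeval_X {n : ℕ} (φ : ℤ[X]) (i i' : Fin n) :
    pderiv i (Polynomial.aeval (X i' : MvPolynomial (Fin n) ℤ) φ)
      = if i = i' then Polynomial.aeval (X i : MvPolynomial (Fin n) ℤ) (derivative φ) else 0 := by
  classical
  rw [Derivation.map_aeval, pderiv_X]
  by_cases h : i = i'
  · subst h; simp
  · rw [if_neg h, Pi.single_eq_of_ne' h, smul_zero]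

variable {k : ℕ} (Φ : PSystem k) (d n : ℕ) (hnd : n + d ≤ k) (p r : ℕ)

/-- `(univ : Finset (Fin n))` embedded in `Fin k` is `{i : i < n}`. [folklore] -/
theorem map_castLE_univ : (univ : Finset (Fin n)).map (Fin.castLEEmb (show n ≤ k by omega))
    = univ.filter fun i : Fin k => i.val < n := by
  ext i
  simp only [mem_map, mem_univ, true_and, mem_filter, Fin.castLEEmb_apply]
  constructor
  · rintro ⟨i', rfl⟩; exact i'.isLt
  · intro hi; exact ⟨⟨i.val, hi⟩, Fin.ext rfl⟩

/-- Splitting `∑_{i<k} Φ_j(z_i)` into the head `i < n` and the tail `i ≥ n`. [folklore] -/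
theorem tupSum_split (z : Fin k → ℤ) (j : Fin k) :
    tupSum (sysv Φ) z j = ∑ i : Fin n, (Φ j).eval (headN (show n ≤ k by omega) z i)
      + ∑ i ∈ univ.filter (fun i : Fin k => ¬ i.val < n), (Φ j).eval (z i) := by
  classical
  simp only [tupSum, Finset.sum_apply, sysv]
  rw [← sum_filter_add_sum_filter_not univ (fun i : Fin k => i.val < n)]
  congr 1
  rw [← map_castLE_univ d n hnd, sum_map]
  rfl

set_option maxHeartbeats 1600000 in
/-- **`|𝓑*(m)| ≤ n! · (p^r)^{k−n} · ∏_{c<n} p^{r − min(d+c+1,r)}`** by Wooley's theorem: fix the tail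
(`(p^r)^{k−n}` choices) and the residues of `∑Φ_j(z_i)` modulo `p^r` (`p^{max(0,r−j)}` choices each);
then the heads solve `n` congruences modulo `p^r` in `n` unknowns with degrees `1,…,n` and Jacobian
prime to `p`. [cite: Ford2002, proof of Lemma 3.2 ("|𝓑*(m)| ≤ (k−d)! p^{(r−d−1)(r−d)/2+rd}")] -/
theorem card_Bstar_le [hpr : Fact p.Prime] {T mm : ℕ} (hΦ : IsType Φ d T mm) (hr : 1 ≤ r) (m : Fin k → ℤ) :
    (Bstar Φ d n hnd p r m).card
      ≤ n.factorial * (((p ^ r) ^ (k - n)) * ∏ c : Fin n, p ^ (r - min (d + c.val + 1) r)) := by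
  classical
  have hp : 0 < p := hpr.out.pos
  set M : ℤ := (p : ℤ) ^ r with hM
  have hM0 : 0 < M := by positivity
  set mn : Fin n → ℤ := fun c => (p : ℤ) ^ min (d + c.val + 1) r with hmn
  have hmn0 : ∀ c, 0 < mn c := fun c => by positivity
  have hmnM : ∀ c, mn c * (p : ℤ) ^ (r - min (d + c.val + 1) r) = M := by
    intro c; rw [hmn, hM]; simp only; rw [← pow_add]; congr 1; omega
  have hmn_dvd : ∀ c, mn c ∣ M := fun c => ⟨_, (hmnM c).symm⟩
  -- the key
  set tailPart : (Fin k → ℤ) → (Fin k → ℤ) := fun zb i => if i.val < n then 0 else zb i with htail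
  set ρvec : (Fin k → ℤ) → (Fin n → ℤ) := fun zb c => (tupSum (sysv Φ) zb (colIdx d n hnd c) % M) / mn c with hρ
  set Tset := (Bstar Φ d n hnd p r m).image tailPart with hTset
  set Rset : Finset (Fin n → ℤ) := Fintype.piFinset fun c => Finset.Ico (0 : ℤ) ((p : ℤ) ^ (r - min (d + c.val + 1) r)) with hRset
  have hkey : ∀ zb ∈ Bstar Φ d n hnd p r m, (tailPart zb, ρvec zb) ∈ Tset ×ˢ Rset := by
    intro zb hzb
    rw [mem_product]
    refine ⟨mem_image_of_mem _ hzb, ?_⟩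
    rw [hRset, Fintype.mem_piFinset]; intro c
    rw [Finset.mem_Ico]
    have h1 : 0 ≤ tupSum (sysv Φ) zb (colIdx d n hnd c) % M := Int.emod_nonneg _ hM0.ne'
    have h2 : tupSum (sysv Φ) zb (colIdx d n hnd c) % M < M := Int.emod_lt_of_pos _ hM0
    refine ⟨Int.ediv_nonneg h1 (hmn0 c).le, ?_⟩
    have h2' : tupSum (sysv Φ) zb (colIdx d n hnd c) % M < (p : ℤ) ^ (r - min (d + c.val + 1) r) * mn c := by
      rw [mul_comm, hmnM c]; exact h2
    exact Int.ediv_lt_of_lt_mul (hmn0 c) h2'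
  -- Step 1: fibres
  rw [card_eq_sum_card_fiberwise (f := fun zb => (tailPart zb, ρvec zb)) (t := Tset ×ˢ Rset) fun zb hzb => hkey zb (mem_coe.1 hzb)]
  -- Step 2: each fibre has at most `n!` elements
  have hfib : ∀ tρ ∈ Tset ×ˢ Rset,
      ((Bstar Φ d n hnd p r m).filter fun zb => (tailPart zb, ρvec zb) = tρ).card ≤ n.factorial := by
    rintro ⟨t, ρ⟩ _
    set Fib := (Bstar Φ d n hnd p r m).filter fun zb => (tailPart zb, ρvec zb) = (t, ρ) with hFib
    have hn : n ≤ k := by omega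
    -- `headN` is injective on the fibre
    have hinj : Set.InjOn (headN hn) ↑Fib := by
      intro zb hzb zb' hzb' hh
      rw [mem_coe, hFib, mem_filter] at hzb hzb'
      funext i
      by_cases hi : i.val < n
      · have := congrFun hh ⟨i.val, hi⟩; simpa [headN] using this
      · have h1 := congrFun (congrArg Prod.fst hzb.2) i
        have h2 := congrFun (congrArg Prod.fst hzb'.2) i
        simp only [htail, if_neg hi] at h1 h2
        rw [h1, h2]
    rw [← card_image_of_injOn hinj]
    set H := Fib.image (headN hn) with hH
    -- the polynomials
    set Kc : Fin n → ℤ := fun c => (∑ i ∈ univ.filter (fun i : Fin k => ¬ i.val < n), (Φ (colIdx d n hnd c)).eval (t i))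
      - (m (colIdx d n hnd c) + mn c * ρ c) with hKc
    set F : Fin n → MvPolynomial (Fin n) ℤ := fun c =>
      (∑ i : Fin n, Polynomial.aeval (MvPolynomial.X i : MvPolynomial (Fin n) ℤ) (Φ (colIdx d n hnd c)))
        + MvPolynomial.C (Kc c) with hF
    -- evaluation of `F c` at a head
    have hevalF : ∀ zb ∈ Fib, ∀ c, MvPolynomial.eval (headN hn zb) (F c)
        = tupSum (sysv Φ) zb (colIdx d n hnd c) - (m (colIdx d n hnd c) + mn c * ρ c) := by
      intro zb hzb c
      rw [hFib, mem_filter] at hzb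
      have ht : tailPart zb = t := congrArg Prod.fst hzb.2
      have e : ∑ i ∈ univ.filter (fun i : Fin k => ¬ i.val < n), (Φ (colIdx d n hnd c)).eval (t i)
          = ∑ i ∈ univ.filter (fun i : Fin k => ¬ i.val < n), (Φ (colIdx d n hnd c)).eval (zb i) := by
        refine sum_congr rfl fun i hi => ?_
        rw [mem_filter] at hi
        rw [← ht]; simp only [htail, if_neg hi.2]
      simp only [hF, hKc, map_add, map_sum, MvPolynomial.eval_C, eval_aeval_X]
      rw [tupSum_split Φ d n hnd zb, e]; ring
    -- (hsol)
    have hsol : ∀ x ∈ H, ∀ c, (p : ℤ) ^ r ∣ MvPolynomial.eval x (F c) := by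
      intro x hx c
      rw [hH, mem_image] at hx
      obtain ⟨zb, hzb, rfl⟩ := hx
      rw [hevalF zb hzb c]
      have hzb' := hzb
      rw [hFib, mem_filter] at hzb'
      have hρc : ρvec zb = ρ := congrArg Prod.snd hzb'.2
      have hB := hzb'.1
      rw [Bstar, mem_filter] at hB
      have hmk := hB.2.2 (colIdx d n hnd c) (by simp [colIdx])
      simp only [mkey, colIdx, le_add_iff_nonneg_right, zero_le, if_true] at hmk
      set S := tupSum (sysv Φ) zb (colIdx d n hnd c) with hS
      have hSm : S % mn c = m ⟨d + c.val, by omega⟩ := hmk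
      have hρ' : (S % M) / mn c = ρ c := by rw [← hρc]
      -- `S % M = mn c * ρ c + m_j`
      have hdecomp : S % M = mn c * ρ c + m ⟨d + c.val, by omega⟩ := by
        rw [← hρ', ← hSm, ← Int.emod_emod_of_dvd S (hmn_dvd c)]
        have := Int.emod_def (S % M) (mn c)
        linarith
      have e : S - (m (colIdx d n hnd c) + mn c * ρ c) = S - S % M := by
        rw [hdecomp]; simp only [colIdx]; ring
      rw [← hM, e, Int.emod_def]
      exact ⟨S / M, by ring⟩
    -- (hjac)
    have hjac : ∀ x ∈ H, ¬ (p : ℤ) ∣ MvPolynomial.eval x (Wooley.jacPoly F).det := by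
      intro x hx
      rw [hH, mem_image] at hx
      obtain ⟨zb, hzb, rfl⟩ := hx
      rw [hFib, mem_filter, Bstar, mem_filter] at hzb
      have hndvd := hzb.1.2.1
      have e : MvPolynomial.eval (headN hn zb) (Wooley.jacPoly F).det = jac Φ d n hnd (headN hn zb) := by
        rw [RingHom.map_det, jac, ← Matrix.det_transpose (jacM Φ d n hnd _)]
        congr 1
        ext c i
        simp only [RingHom.mapMatrix_apply, Matrix.map_apply, Wooley.jacPoly, Matrix.of_apply,
          Matrix.transpose_apply, jacM, hF, map_add, MvPolynomial.pderiv_C, add_zero, map_sum,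
          pderiv_aeval_X]
        rw [Finset.sum_eq_single i]
        · rw [if_pos rfl, eval_aeval_X]
        · intro i' _ hne; rw [if_neg (Ne.symm hne), map_zero]
        · intro h; exact absurd (mem_univ i) h
      rw [e]
      convert hndvd using 2
    -- (hinc)
    have hinc : ∀ x ∈ H, ∀ y ∈ H, (∀ i, (p : ℤ) ^ r ∣ x i - y i) → x = y := by
      intro x hx y hy hxy
      rw [hH, mem_image] at hx hy
      obtain ⟨zb, hzb, rfl⟩ := hx
      obtain ⟨zb', hzb', rfl⟩ := hy
      rw [hFib, mem_filter, Bstar, mem_filter, mem_tuples] at hzb hzb'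
      funext i
      have h1 := hzb.1.1 (Fin.castLE hn i)
      have h2 := hzb'.1.1 (Fin.castLE hn i)
      rw [Finset.mem_Ico] at h1 h2
      obtain ⟨h1a, h1b⟩ := h1
      obtain ⟨h2a, h2b⟩ := h2
      have hd := hxy i
      simp only [headN] at hd ⊢
      obtain ⟨t', ht'⟩ := hd
      have habs : |zb (Fin.castLE hn i) - zb' (Fin.castLE hn i)| < M := by
        rw [abs_lt]; constructor <;> linarith
      rw [ht', abs_mul, abs_of_pos hM0] at habs
      have : |t'| < 1 := by
        by_contra hh; push Not at hh
        have : M * 1 ≤ M * |t'| := mul_le_mul_of_nonneg_left hh hM0.le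
        linarith
      have ht0 : t' = 0 := by rw [abs_lt] at this; omega
      rw [ht0, mul_zero, sub_eq_zero] at ht'
      exact ht'
    have hW := Wooley.card_solutions_le (p := p) F hr H hsol hjac hinc
    refine hW.trans ?_
    -- degrees
    have hdeg : ∀ c : Fin n, (F c).totalDegree ≤ c.val + 1 := by
      intro c
      simp only [hF]
      refine (MvPolynomial.totalDegree_add _ _).trans (max_le ?_ (by rw [MvPolynomial.totalDegree_C]; omega))
      refine MvPolynomial.totalDegree_finsetSum_le fun i _ => (totalDegree_aeval_X_le _ _).trans ?_
      rw [hΦ.deg (colIdx d n hnd c) (by simp [colIdx])]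
      simp only [colIdx]; omega
    calc ∏ c, (F c).totalDegree ≤ ∏ c : Fin n, (c.val + 1) := prod_le_prod' fun c _ => hdeg c
      _ = n.factorial := by rw [Fin.prod_univ_eq_prod_range (fun c => c + 1) n, Finset.prod_range_add_one_eq_factorial]
  -- Step 3: the number of keys
  refine (sum_le_sum hfib).trans ?_
  rw [sum_const, smul_eq_mul, card_product, mul_comm]
  refine Nat.mul_le_mul_left _ ?_
  have hT : Tset.card ≤ (p ^ r) ^ (k - n) := by
    have hinjT : Set.InjOn (fun t : Fin k → ℤ => fun i : Fin (k - n) => t ⟨n + i.val, by omega⟩) ↑Tset := by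
      intro t ht t' ht' htt
      rw [mem_coe, hTset, mem_image] at ht ht'
      obtain ⟨zb, -, rfl⟩ := ht
      obtain ⟨zb', -, rfl⟩ := ht'
      funext i
      by_cases hi : i.val < n
      · simp only [htail, if_pos hi]
      · have := congrFun htt ⟨i.val - n, by omega⟩
        have e : (⟨n + (i.val - n), by omega⟩ : Fin k) = i := Fin.ext (by simp; omega)
        simp only [e] at this
        exact this
    have hsubT : Tset.image (fun t : Fin k → ℤ => fun i : Fin (k - n) => t ⟨n + i.val, by omega⟩)
        ⊆ tuples (k - n) (Finset.Ico (0 : ℤ) M) := by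
      intro u hu
      rw [mem_image] at hu
      obtain ⟨t, ht, rfl⟩ := hu
      rw [hTset, mem_image] at ht
      obtain ⟨zb, hzb, rfl⟩ := ht
      rw [Bstar, mem_filter, mem_tuples] at hzb
      rw [mem_tuples]; intro i
      simp only [htail]
      rw [if_neg (by simp)]
      exact hzb.1 _
    have := card_le_card hsubT
    rw [card_image_of_injOn hinjT, card_tuples, Int.card_Ico, sub_zero, hM] at this
    refine this.trans (le_of_eq ?_)
    have e : ((p : ℤ) ^ r).toNat = p ^ r := by
      rw [show ((p : ℤ) ^ r) = ((p ^ r : ℕ) : ℤ) by norm_cast, Int.toNat_natCast]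
    rw [e]
  have hR : Rset.card = ∏ c : Fin n, p ^ (r - min (d + c.val + 1) r) := by
    rw [hRset, Fintype.card_piFinset]
    refine prod_congr rfl fun c _ => ?_
    rw [Int.card_Ico, sub_zero]
    rw [show ((p : ℤ) ^ (r - min (d + c.val + 1) r)) = ((p ^ (r - min (d + c.val + 1) r) : ℕ) : ℤ) by norm_cast,
      Int.toNat_natCast]
  rw [← hR]
  exact Nat.mul_le_mul_right _ hT

end WooleyBound

end FordVK
end Literature.NumberTheory.LFunctions
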